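import Literature.AnabelianGeometry.EtaleTheta.Discharge.Sec3Thm37iUnitProfiniteAtTateTowerArithPadic
import Literature.AnabelianGeometry.EtaleTheta.Discharge.Sec4MuSaturatedOfRatFnTorsion
import Literature.AnabelianGeometry.EtaleTheta.Discharge.Sec3Thm37UnitsTreeMonoidVocabWeak
import Literature.NumberTheory.LocalFields.PadicRootsOfUnity
import Mathlib.RingTheory.RootsOfUnity.PrimitiveRoots

/-!
# [EtTh] Def. 4.1 (iv)(a) / Def. 5.4 (a) «`μ_M`-saturated» ([FrdII] Def. 2.1 (i)) HOLDS at the p-ADIC ARITHMETIC TATE TOWER for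
# every `M ∣ p − 1` — from an embedding of the unit kernel into a field; generic over every tempered Frobenioid

Mochizuki, *The étale theta function and its Frobenioid-theoretic manifestations*, Publ. RIMS **45** (2009): Def. 4.1 (iv) p.313
(PDF p.87) («`A''` … `μ_N`-saturated»), Def. 5.4 (a) p.327 (PDF p.101) («`S` is `μ_{l·N}`-saturated [cf. [Mzk18], Definition 2.1,
(i)]») [cite: MochizukiEtTh2009, Def 5.4 p.327 (PDF p.101)]; Mochizuki, *The geometry of Frobenioids II*, Kyushu J. Math. **62**
(2008), Def. 2.1 (i) p.16 («`A` is `μ_N`-saturated if the abstract group `μ_N(A)` is isomorphic to `ℤ/Nℤ`») [cite: MochizukiFrdII2008,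
Def. 2.1 (i) p.16]; Prop. 3.4 (ii) p.300 (PDF p.74) (`O_L^× ⥲ Ker(B₀ → Φ₀^gp)`); F. Q. Gouvêa, *p-adic Numbers*, Prop. 4.6.1 (the
roots of unity of `ℚ_p` of order prime to `p` are exactly `μ_{p−1}`) [cite: Gouvea1993PadicNumbers, Prop. 4.6.1 (§4.6)].

abc-iut cell, layer L2, seat abc-iut-L2-t4 (gen 9), row «DEF54a@ARITH-TATE» (abc-iut-L2-lead R1154 / R1162; VNEXT add.13 pulled in).
PROOF-ONLY: no definition, no new `Prop`, no instance, no notation; nothing landed is edited or restated.  Consumed BY NAME: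
abc-iut-w6-d037's `TemperedFrobenioid.isMuSaturated_of_bZero_generator` (`Sec4MuSaturatedOfRatFnTorsion`), abc-iut-w6-d061's
`TateTowerArithFrd.nonempty_ker_mulEquiv_padicUnits` (`Ker(B₀(G/G)ˣ → (Φ₀^rlf)^gp) ≃* ℤ_p^×`, `Sec3Thm37iUnitProfiniteAtTateTowerArithPadic`),
abc-iut-w6-d058/w5-d223's `TateTowerArithFrd.temperedFrobenioid` / `TateTowerArith.Datum.padic`, `isDivisorial_divisorMonoid_treeMonoidVocabWeak`,
and `Literature.NumberTheory.LocalFields.padic_exists_isPrimitiveRoot_of_dvd` (Gouvêa 4.6.1).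

WHAT IS PROVED.
* `TemperedFrobenioid.isMuSaturated_of_kerUnits_embedding` — GENERIC, every tempered Frobenioid `C`, every object `A` with `Φ(A^bs)`
  divisorial: an INJECTIVE homomorphism of the unit kernel `Ker(B₀^Λ(A^bs)ˣ → (Φ^{ℝ-log})^gp(A^bs))` into an integral domain `F`, plus ONE
  kernel element of order `N`, make `A` `μ_N`-saturated (abc-iut-L2-t3's generator form of [FrdII] Def. 2.1 (i)): the `N`-torsion of the
  kernel maps into the `N`-th roots of unity of `F`, which the image of the given element generates (`IsPrimitiveRoot.zpowers_eq`).  The §4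
  twin of the §5 lemma `ThetaFrobenioid.isMuSaturated_of_units_embedding` (p498191).
* `TemperedFrobenioid.exists_kerUnits_orderOf_eq_of_isMuSaturated` — the converse (a generator of `μ_N(A)` is a unit `(b, 0)` of
  `B(A^bs)` with `Div_B = 0`, [FrdI] Thm. 5.2 (ii); its `B₀^Λ`-component lies in the kernel with the same order); hence
  `isMuSaturated_iff_exists_kerUnits_orderOf_eq` — with an injective kernel reading into an integral domain, `A` is `μ_N`-saturated
  IFF the kernel has an element of order `N`.
* **`TateTowerArithFrd.isMuSaturated_padic_of_dvd`** — at the arithmetic Tate tower over `ℚ_p` (`TateTowerArithFrd.temperedFrobenioid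
  (Datum.padic p) R S`, one point of `D₀`, constants `ℚ_p`, unit kernel `≅ ℤ_p^×`): **every object is `μ_M`-saturated for every
  `M ∣ p − 1`** (`μ_{p−1} ⊆ ℤ_p^×`, Gouvêa 4.6.1).  Read for Def. 5.4 (a): `μ_{l·N}`-saturated whenever `l·N ∣ p − 1` — e.g. `p = 13`,
  `(l, N) = (3, 4)` (`isMuSaturated_padic_thirteen_twelve`); `p = 7`, `(l, N) = (3, 2)` — odd `l > 1` at a class-(b) model of record.
* `TateTowerArithFrd.not_isMuSaturated_padic` / **`isMuSaturated_padic_iff`** — the converse at this carrier: for `p ∤ M`, every object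
  is `μ_M`-saturated IFF `M ∣ p − 1` (a unit of order `M` reads as a primitive `M`-th root of unity in `ℚ_p`; Gouvêa 4.6.1 ⇒);
  so Def. 5.4 (a) holds at this carrier for `(l, N)` iff `l·N ∣ p − 1` (when `p ∤ l·N`).
HONEST LABEL (abc-iut-L2-lead R1162): this is the §4 / [FrdII] Def. 2.1 (i) predicate `TemperedFrobenioid.IsMuSaturated` at the p-adic
arithmetic Tate tower (a class-(b) arithmetic consistency witness over ONE point of `D₀`, not the formal-scheme tower), NOT the §5 predicate
`ThetaFrobenioid.IsThetaSaturated` (no `ThetaFrobenioid` structure exists over this tempered Frobenioid); the cell's Def. 5.4 count is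
unchanged by this file.  [EtTh]/[FrdII] are refereed papers; nothing here bears on [IUTchIII] Cor. 3.12 — no side taken; nothing asserts
abc proved or refuted.
-/

noncomputable section

namespace Literature.AnabelianGeometry.EtaleTheta

open CategoryTheory Opposite Function Literature.AlgebraicGeometry.Frobenioids

universe u₀ v₀ u v w

/-! ### Generic: `μ_N`-saturation from an embedding of the unit kernel into a field -/

namespace TemperedFrobenioid

variable {D₀ : Type u₀} [Category.{v₀} D₀] {V : FrdIMonoidStub.{w}} {T : RealifiedDivisorMonoids (D₀ := D₀) V}
  {D : Type u} [Category.{v} D] {VD : FrdICatStub.{u, v, w} D} (C : TemperedFrobenioid T D VD)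

/-- **[FrdII] Def. 2.1 (i) / [EtTh] Def. 4.1 (iv)(a), Def. 5.4 (a) from an embedding of the unit kernel into a field**: for an object `A`
of a tempered Frobenioid with `Φ(A^bs)` divisorial, if the kernel `Ker(B₀^Λ(A^bs)ˣ → (Φ^{ℝ-log})^gp(A^bs))` (`= O^×(A)`, [FrdI] Thm. 5.2 (ii) /
Prop. 3.4 (ii)) embeds injectively into an integral domain `F` and contains an element of order `N`, then `A` is `μ_N`-saturated — the
`N`-torsion of the kernel is carried into `μ_N(F)`, generated there by the image of that element.
[cite: MochizukiEtTh2009, Def 4.1 (iv) p.313 (PDF p.87); Def 5.4 p.327 (PDF p.101)] [cite: MochizukiFrdII2008, Def. 2.1 (i) p.16] -/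
theorem isMuSaturated_of_kerUnits_embedding (A : C.category) (hΦ : IsDivisorial (C.divisorMonoid.obj (op A.base))) (N : ℕ+)
    {F : Type*} [CommRing F] [IsDomain F]
    (j : ((T.divΛ (C.baseOp (op A.base))).comp (Units.coeHom (T.BΛ.obj (C.baseOp (op A.base))))).ker →* F)
    (hj : Function.Injective j)
    (hζ : ∃ z ∈ ((T.divΛ (C.baseOp (op A.base))).comp (Units.coeHom (T.BΛ.obj (C.baseOp (op A.base))))).ker,
      orderOf z = (N : ℕ)) :
    C.IsMuSaturated A N := by
  classical
  haveI : NeZero (N : ℕ) := ⟨N.ne_zero⟩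
  obtain ⟨z, hz, hord⟩ := hζ
  have hz1 : T.divΛ (C.baseOp (op A.base)) (z : T.BΛ.obj (C.baseOp (op A.base))) = 1 := by
    have h := MonoidHom.mem_ker.mp hz
    rwa [MonoidHom.comp_apply, Units.coeHom_apply] at h
  refine C.isMuSaturated_of_bZero_generator A hΦ N z hz1 hord fun b hb hbN => ?_
  have hbK : b ∈ ((T.divΛ (C.baseOp (op A.base))).comp (Units.coeHom (T.BΛ.obj (C.baseOp (op A.base))))).ker := by
    rw [MonoidHom.mem_ker, MonoidHom.comp_apply, Units.coeHom_apply]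
    exact hb
  -- the unit-valued embedding of the kernel
  have hju : Function.Injective j.toHomUnits := fun x y h =>
    hj (by simpa only [MonoidHom.coe_toHomUnits] using congrArg (fun u : Fˣ => (u : F)) h)
  -- `j z` is a primitive `N`-th root of unity of `F`
  have hordK : orderOf (⟨z, hz⟩ :
      ((T.divΛ (C.baseOp (op A.base))).comp (Units.coeHom (T.BΛ.obj (C.baseOp (op A.base))))).ker) = (N : ℕ) :=
    (orderOf_injective (Subgroup.subtype _) Subtype.coe_injective ⟨z, hz⟩).symm.trans hord
  have hprim : IsPrimitiveRoot (j.toHomUnits ⟨z, hz⟩) N := by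
    have h := IsPrimitiveRoot.orderOf (j.toHomUnits ⟨z, hz⟩)
    rwa [orderOf_injective j.toHomUnits hju, hordK] at h
  -- `j b` is an `N`-th root of unity, hence a power of `j z`
  have hbK' : (⟨b, hbK⟩ :
      ((T.divΛ (C.baseOp (op A.base))).comp (Units.coeHom (T.BΛ.obj (C.baseOp (op A.base))))).ker) ^ (N : ℕ) = 1 :=
    Subtype.ext (by rw [SubmonoidClass.coe_pow, hbN]; rfl)
  have hmem : j.toHomUnits ⟨b, hbK⟩ ∈ rootsOfUnity N F := by
    rw [mem_rootsOfUnity, ← map_pow, hbK', map_one]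
  rw [← hprim.zpowers_eq] at hmem
  obtain ⟨i, hi⟩ := Subgroup.mem_zpowers_iff.mp hmem
  have hzi : (⟨z, hz⟩ :
      ((T.divΛ (C.baseOp (op A.base))).comp (Units.coeHom (T.BΛ.obj (C.baseOp (op A.base))))).ker) ^ i = ⟨b, hbK⟩ :=
    hju (by rw [map_zpow, hi])
  exact Subgroup.mem_zpowers_iff.mpr ⟨i, by
    have h := congrArg Subtype.val hzi
    rwa [SubgroupClass.coe_zpow] at h⟩

/-- **Conversely, a `μ_N`-saturated object has a unit-kernel element of order `N`**: a generator `σ` of `μ_N(A)` is a unit `(b, 0)` of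
`B(A^bs) = B₀^Λ ×_{(Φ^{ℝ-log})^gp} Φ^gp` with `Div_B = 0` ([FrdI] Thm. 5.2 (ii), abc-iut-w6-d037's `isMuSaturated_iff_ratFnTorsion`), whose
`B₀^Λ`-component `b` lies in the kernel and has the same order.  [cite: MochizukiEtTh2009, Def 4.1 (iv) p.313 (PDF p.87)]
[cite: MochizukiFrdII2008, Def. 2.1 (i) p.16] -/
theorem exists_kerUnits_orderOf_eq_of_isMuSaturated (A : C.category) (hΦ : IsDivisorial (C.divisorMonoid.obj (op A.base)))
    (N : ℕ+) (h : C.IsMuSaturated A N) :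
    ∃ z ∈ ((T.divΛ (C.baseOp (op A.base))).comp (Units.coeHom (T.BΛ.obj (C.baseOp (op A.base))))).ker,
      orderOf z = (N : ℕ) := by
  obtain ⟨ζ, hζ1, hord, -⟩ := (C.isMuSaturated_iff_ratFnTorsion A hΦ N).mp h
  -- the `B₀^Λ`-component, a monoid homomorphism `B(A^bs) → B₀^Λ(A^bs)`
  let π : (C.ratFnFunctor.obj (op A.base)) →* T.BΛ.obj (C.baseOp (op A.base)) :=
    { toFun := fun x => x.1.1
      map_one' := rfl
      map_mul' := fun _ _ => rfl }
  have hπ : ∀ x : C.ratFnFunctor.obj (op A.base), π x = x.1.1 := fun _ => rfl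
  -- powers are computed componentwise
  have hval : ∀ n : ℕ, ((ζ : C.ratFnFunctor.obj (op A.base)) ^ n).1 = ((ζ : C.ratFnFunctor.obj (op A.base)).1) ^ n :=
    fun n => by
      induction n with
      | zero => rfl
      | succ n ih => rw [pow_succ, pow_succ, ← ih]; rfl
  have hζ2 : (ζ : C.ratFnFunctor.obj (op A.base)).1.2 = 1 := hζ1
  have hrel : T.divΛ (C.baseOp (op A.base)) (ζ : C.ratFnFunctor.obj (op A.base)).1.1 =
      C.ΦgpToRlog (op A.base) (ζ : C.ratFnFunctor.obj (op A.base)).1.2 :=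
    (ζ : C.ratFnFunctor.obj (op A.base)).2
  refine ⟨Units.map π ζ, ?_, ?_⟩
  · rw [MonoidHom.mem_ker, MonoidHom.comp_apply, Units.coeHom_apply, Units.coe_map, hπ, hrel, hζ2, map_one]
  · rw [← hord]
    refine orderOf_eq_orderOf_iff.mpr fun n => ⟨fun hn => ?_, fun hn => by rw [← map_pow, hn, map_one]⟩
    -- `(π ζ)^n = 1` forces `ζ^n = 1`, the `Φ^gp`-component of `ζ` being trivial
    have h1 : (((ζ : C.ratFnFunctor.obj (op A.base)).1) ^ n).1 = 1 := by
      have h := congrArg (fun u : (T.BΛ.obj (C.baseOp (op A.base)))ˣ => (u : T.BΛ.obj (C.baseOp (op A.base)))) hn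
      simp only [← map_pow, Units.coe_map, Units.val_one, Units.val_pow_eq_pow_val] at h
      rw [hπ, hval] at h
      exact h
    refine Units.ext (Subtype.ext ?_)
    rw [Units.val_pow_eq_pow_val, hval, Units.val_one]
    refine Prod.ext ?_ ?_
    · rw [h1]; rfl
    · rw [Prod.pow_snd, hζ2, one_pow]; rfl

/-- Hence, **when the unit kernel embeds into an integral domain, `A` is `μ_N`-saturated iff the kernel has an element of order `N`.**
[cite: MochizukiEtTh2009, Def 4.1 (iv) p.313 (PDF p.87)] [cite: MochizukiFrdII2008, Def. 2.1 (i) p.16] -/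
theorem isMuSaturated_iff_exists_kerUnits_orderOf_eq (A : C.category) (hΦ : IsDivisorial (C.divisorMonoid.obj (op A.base)))
    (N : ℕ+) {F : Type*} [CommRing F] [IsDomain F]
    (j : ((T.divΛ (C.baseOp (op A.base))).comp (Units.coeHom (T.BΛ.obj (C.baseOp (op A.base))))).ker →* F)
    (hj : Function.Injective j) :
    C.IsMuSaturated A N ↔
      ∃ z ∈ ((T.divΛ (C.baseOp (op A.base))).comp (Units.coeHom (T.BΛ.obj (C.baseOp (op A.base))))).ker,
        orderOf z = (N : ℕ) :=
  ⟨C.exists_kerUnits_orderOf_eq_of_isMuSaturated A hΦ N, C.isMuSaturated_of_kerUnits_embedding A hΦ N j hj⟩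

end TemperedFrobenioid

/-! ### At the p-adic arithmetic Tate tower: `μ_M`-saturation for every `M ∣ p − 1` -/

namespace TateTowerArithFrd

open LogDivisorModel LogDivisorModel.GaloisAction LogDivisorModel.TateTowerArith PadicDivisible

variable (p : ℕ) [hp : Fact p.Prime] (R S : ((Discrete PUnit.{1})ᵒᵖ ⥤ CommMonCat.{0}) → Prop)

/-- A primitive `M`-th root of unity of `ℚ_p` lies in `ℤ_p^× = PadicFrd.unitSubgroup ℚ_[p]` (its norm is `1`).
[cite: Gouvea1993PadicNumbers, Prop. 4.6.1 (§4.6)] -/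
theorem isUnit_unit_mem_unitSubgroup_of_isPrimitiveRoot {M : ℕ} (hM : M ≠ 0) {ζ : ℚ_[p]} (hζ : IsPrimitiveRoot ζ M) :
    (hζ.isUnit hM).unit ∈ PadicFrd.unitSubgroup ℚ_[p] := by
  rw [PadicFrd.mem_unitSubgroup_iff, IsUnit.unit_spec,
    valuativeRel_valuation_eq_one_iff_norm p (hζ.isUnit hM).ne_zero]
  exact Literature.NumberTheory.LocalFields.padic_norm_eq_one_of_pow_eq_one hM hζ.pow_eq_one

/-- **[EtTh] Def. 4.1 (iv)(a) / Def. 5.4 (a) — [FrdII] Def. 2.1 (i) — at the p-ADIC ARITHMETIC TATE TOWER**: every object of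
`TateTowerArithFrd.temperedFrobenioid (Datum.padic p) R S` is `μ_M`-saturated for every `M ∣ p − 1`.  The unit kernel of `B₀(G/G)` is
`ℤ_p^×` (Prop. 3.4 (ii) iso 1, w6-d061), which embeds in `ℚ_p` and contains `μ_{p−1}` (Gouvêa 4.6.1); `Φ(G/G)` is divisorial.
For Def. 5.4 (a): `μ_{l·N}`-saturated whenever `l·N ∣ p − 1` (e.g. `p = 13`, `(l, N) = (3, 4)`).
[cite: MochizukiEtTh2009, Def 4.1 (iv) p.313 (PDF p.87); Def 5.4 p.327 (PDF p.101); Prop 3.4 (ii) p.300 (PDF p.74)]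
[cite: MochizukiFrdII2008, Def. 2.1 (i) p.16] [cite: Gouvea1993PadicNumbers, Prop. 4.6.1 (§4.6)] -/
theorem isMuSaturated_padic_of_dvd (A : (temperedFrobenioid (Datum.padic p) R S).category) (M : ℕ+) (hM : (M : ℕ) ∣ p - 1) :
    (temperedFrobenioid (Datum.padic p) R S).IsMuSaturated A M := by
  -- the unit kernel over the base of `A` IS the kernel at `G/G` (the base functor is constant at `G/G`)
  obtain ⟨e⟩ : Nonempty ((((RealifiedDivisorMonoids.ofRlfZWeak (dm (Datum.padic p)) (hpf (Datum.padic p))).divΛ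
      ((temperedFrobenioid (Datum.padic p) R S).baseOp (op A.base))).comp
        (Units.coeHom ((RealifiedDivisorMonoids.ofRlfZWeak (dm (Datum.padic p)) (hpf (Datum.padic p))).BΛ.obj
          ((temperedFrobenioid (Datum.padic p) R S).baseOp (op A.base))))).ker ≃* PadicFrd.unitSubgroup ℚ_[p]) :=
    nonempty_ker_mulEquiv_padicUnits p
  obtain ⟨ζ, hζ⟩ := Literature.NumberTheory.LocalFields.padic_exists_isPrimitiveRoot_of_dvd (p := p) hM
  have hζu : IsPrimitiveRoot (hζ.isUnit M.ne_zero).unit M := hζ.isUnit_unit M.ne_zero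
  have hmem := isUnit_unit_mem_unitSubgroup_of_isPrimitiveRoot p M.ne_zero hζ
  -- the embedding `Ker ≃* ℤ_p^× ↪ ℚ_p`
  have hj : Function.Injective (((Units.coeHom ℚ_[p]).comp (PadicFrd.unitSubgroup ℚ_[p]).subtype).comp e.toMonoidHom) :=
    (Units.val_injective.comp Subtype.coe_injective).comp e.injective
  -- the element of order `M`: `e⁻¹(ζ)`
  have hordz : orderOf (e.symm ⟨(hζ.isUnit M.ne_zero).unit, hmem⟩) = (M : ℕ) := by
    rw [MulEquiv.orderOf_eq, ← orderOf_injective (PadicFrd.unitSubgroup ℚ_[p]).subtype Subtype.coe_injective,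
      Subgroup.coe_subtype]
    exact hζu.eq_orderOf.symm
  refine (temperedFrobenioid (Datum.padic p) R S).isMuSaturated_of_kerUnits_embedding A
    ((temperedFrobenioid (Datum.padic p) R S).isDivisorial_divisorMonoid_treeMonoidVocabWeak A.base) M _ hj
    ⟨_, (e.symm ⟨(hζ.isUnit M.ne_zero).unit, hmem⟩).2, ?_⟩
  exact (orderOf_injective (Subgroup.subtype _) Subtype.coe_injective _).trans hordz

/-- **The converse at the p-adic arithmetic Tate tower**: if `p ∤ M` and `M ∤ p − 1` then NO object is `μ_M`-saturated — a unit of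
order `M` of an object would give, through `O^×(A) ↪ B(A^bs)ˣ` ([FrdI] Thm. 5.2 (ii)), its `B₀(G/G)`-component and the unit kernel
`≅ ℤ_p^× ⊆ ℚ_p` (Prop. 3.4 (ii)), a primitive `M`-th root of unity in `ℚ_p`, forcing `M ∣ p − 1` (Gouvêa 4.6.1).  So at this carrier
Def. 5.4 (a) holds for `(l, N)` iff `l·N ∣ p − 1` (when `p ∤ l·N`).
[cite: MochizukiEtTh2009, Def 5.4 p.327 (PDF p.101); Prop 3.4 (ii) p.300 (PDF p.74)] [cite: Gouvea1993PadicNumbers, Prop. 4.6.1 (§4.6)] -/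
theorem not_isMuSaturated_padic (A : (temperedFrobenioid (Datum.padic p) R S).category) (M : ℕ+)
    (hpM : ¬ p ∣ (M : ℕ)) (hM : ¬ (M : ℕ) ∣ p - 1) : ¬ (temperedFrobenioid (Datum.padic p) R S).IsMuSaturated A M := by
  intro h
  obtain ⟨z, hz, hord⟩ := (temperedFrobenioid (Datum.padic p) R S).exists_kerUnits_orderOf_eq_of_isMuSaturated A
    ((temperedFrobenioid (Datum.padic p) R S).isDivisorial_divisorMonoid_treeMonoidVocabWeak A.base) M h
  obtain ⟨e⟩ : Nonempty ((((RealifiedDivisorMonoids.ofRlfZWeak (dm (Datum.padic p)) (hpf (Datum.padic p))).divΛ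
      ((temperedFrobenioid (Datum.padic p) R S).baseOp (op A.base))).comp
        (Units.coeHom ((RealifiedDivisorMonoids.ofRlfZWeak (dm (Datum.padic p)) (hpf (Datum.padic p))).BΛ.obj
          ((temperedFrobenioid (Datum.padic p) R S).baseOp (op A.base))))).ker ≃* PadicFrd.unitSubgroup ℚ_[p]) :=
    nonempty_ker_mulEquiv_padicUnits p
  -- read in `ℚ_p`: `e z ∈ ℤ_p^×` is a primitive `M`-th root of unity
  have hordK : orderOf (⟨z, hz⟩ : (((RealifiedDivisorMonoids.ofRlfZWeak (dm (Datum.padic p)) (hpf (Datum.padic p))).divΛ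
      ((temperedFrobenioid (Datum.padic p) R S).baseOp (op A.base))).comp (Units.coeHom _)).ker) = (M : ℕ) :=
    (orderOf_injective (Subgroup.subtype _) Subtype.coe_injective ⟨z, hz⟩).symm.trans hord
  have hordq : orderOf (((e ⟨z, hz⟩ : PadicFrd.unitSubgroup ℚ_[p]) : ℚ_[p]ˣ) : ℚ_[p]) = (M : ℕ) := by
    rw [orderOf_units, ← Subgroup.coe_subtype, orderOf_injective (PadicFrd.unitSubgroup ℚ_[p]).subtype Subtype.coe_injective,
      MulEquiv.orderOf_eq, hordK]
  have hprim : IsPrimitiveRoot (((e ⟨z, hz⟩ : PadicFrd.unitSubgroup ℚ_[p]) : ℚ_[p]ˣ) : ℚ_[p]) (M : ℕ) := by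
    rw [← hordq]; exact IsPrimitiveRoot.orderOf _
  exact hM (Literature.NumberTheory.LocalFields.dvd_sub_one_of_isPrimitiveRoot_padic hpM hprim)

/-- **At the p-adic arithmetic Tate tower `μ_M`-saturation is DECIDED for every `M` prime to `p`: every object is `μ_M`-saturated iff
`M ∣ p − 1`** — Def. 5.4 (a) at this carrier holds for `(l, N)` iff `l·N ∣ p − 1` (when `p ∤ l·N`).
[cite: MochizukiEtTh2009, Def 5.4 p.327 (PDF p.101)] [cite: Gouvea1993PadicNumbers, Prop. 4.6.1 (§4.6)] -/
theorem isMuSaturated_padic_iff (A : (temperedFrobenioid (Datum.padic p) R S).category) (M : ℕ+) (hpM : ¬ p ∣ (M : ℕ)) :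
    (temperedFrobenioid (Datum.padic p) R S).IsMuSaturated A M ↔ (M : ℕ) ∣ p - 1 :=
  ⟨fun h => by_contra fun hM => not_isMuSaturated_padic p R S A M hpM hM h, isMuSaturated_padic_of_dvd p R S A M⟩

/-- In particular, for Def. 5.4 (a) with `(l, N)`: every object is `μ_{l·N}`-saturated as soon as `l·N ∣ p − 1`.
[cite: MochizukiEtTh2009, Def 5.4 p.327 (PDF p.101)] -/
theorem isMuSaturated_padic_mul_of_dvd (A : (temperedFrobenioid (Datum.padic p) R S).category) (l N : ℕ+)
    (h : (l : ℕ) * (N : ℕ) ∣ p - 1) : (temperedFrobenioid (Datum.padic p) R S).IsMuSaturated A (l * N) :=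
  isMuSaturated_padic_of_dvd p R S A (l * N) (by rwa [PNat.mul_coe])

/-- The numerical example of the docstring: at `p = 13`, `(l, N) = (3, 4)` — every object of the `ℚ_13` arithmetic Tate tower is
`μ_12`-saturated. [cite: MochizukiEtTh2009, Def 5.4 p.327 (PDF p.101)] -/
theorem isMuSaturated_padic_thirteen_twelve [Fact (Nat.Prime 13)] (R' S' : ((Discrete PUnit.{1})ᵒᵖ ⥤ CommMonCat.{0}) → Prop)
    (A : (temperedFrobenioid (Datum.padic 13) R' S').category) :
    (temperedFrobenioid (Datum.padic 13) R' S').IsMuSaturated A (3 * 4) :=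
  isMuSaturated_padic_mul_of_dvd 13 R' S' A 3 4 ⟨1, by norm_num⟩

end TateTowerArithFrd

end Literature.AnabelianGeometry.EtaleTheta

end
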